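import Summits.BirchSwinnertonDyer.Rank1Residual.Additive.KatoDescentAdmissibleIstarZero
import HarnessLib

set_option autoImplicit false

/-!
# The OFF-`μ` half of Kato's 12.10 length equality ON THE CLASS 𝒞₇ AT `p = 7` (crux stmt-BirchSwinnertonDyer-19945, zp line) FROM
# THE PRINTED THEOREM Burungale–Tian 2026 Thm. 2.6, and the split of the zp skeleton's research stub
# `stub_katoMainConjectureFineSeven : ∀ W, X12.ClassCSeven W → KatoMainConjectureFineContra W 7` into
# {∃ an admissible class (research: integrality at the reducible prime 7), OFF-μ (PRINT, the named fact), μ-equality (research)}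

Seat `bsd-cm-prr-ty1` (generation 20, literature-prover; cell `bsd-cm`, HOME `run/shared/lean/pub/bsd-cm/`), item (T20-Z) = the 19945 twin of
(T20-F)(c) (p737094).  THEOREMS ONLY; no `def`, no named fact, no instance, no notation, no `sorry`.  Burungale–Tian's Theorem 2.6 («Let f be
a CM newform and p a prime» — ANY p, in particular p = 7 RAMIFIED in K = ℚ(√−7), where Kato's own §15 runs through 15.14) is the tree's named
fact `Literature.NumberTheory.EllipticCurves.Kato2004.BurungaleTian2026_lengthEq_offMu_of_hasCM` (p736588); it is consumed here BY VALUE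
(hypothesis `hfact` = its `def` body VERBATIM), so the zp skeleton can feed the fact term itself (δ-unfolding), as p737094 does for istar.
On 𝒞₇: `W.HasCM = hC.1` (`X12.ClassCSeven W = W.HasCM ∧ …`), `7 ≠ 2`.  What is NOT print on 𝒞₇ × {7} stays hypothesis: the EXISTENCE of an
admissible zeta class (Kato 12.5 (4)/15.21 need `W[7]` irreducible — false on 𝒞₇, seat g19 memo INTEGRALITY-AUDIT F3) and the μ-equality at
`𝔮 = (7)` (Burungale–Tian Rem. 2.7).

* `StrictCount.katoLengthEqualityOffMu_classCSeven_of_fact (hfact)` — OFF-μ on 𝒞₇ at 7 for every cyclotomic datum/pin/admissible class/`Y`/`𝔮 ≠ (7)`.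
* `StrictCount.katoMainConjectureFineContra_classCSeven_of_exists_of_fact_of_atMu (hex) (hfact) (hat)` — the registered stub's type
  `∀ W, X12.ClassCSeven W → KatoMainConjectureFineContra W 7` VERBATIM from the three displayed hypotheses (`by_cases` on `𝔮.asIdeal = augIdealP 7`).

HONEST LABEL: conditional re-keyings; nothing asserted; no stub closed; 19945 stays OPEN; `X12.CMRamifiedSeven` NOT proved; BSD is proved for no
curve.  References: A. Burungale, Y. Tian, Ann. of Math. 203 (2026) Thm. 2.6, Rem. 2.7 [BurungaleTian2026]; K. Kato, Astérisque 295 (2004)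
Conj. 12.10 (p. 224), §15.14 (p. 264), Prop. 15.17 (p. 265) [Kato2004Asterisque]; tree p736588, p737094, p731778; memos
pub/bsd-cm/bsd-cm-prr-ty1/g20/LENGTH-EQUALITY-AUDIT.md (v3 §0′), g19/INTEGRALITY-AUDIT.md (F3).
-/

noncomputable section

open scoped Classical NumberField

open WeierstrassCurve Field IsDedekindDomain NumberField Rat.HeightOneSpectrum Literature.NumberTheory.EllipticCurves
  Literature.NumberTheory.EllipticCurves.Rank1Residual Literature.NumberTheory.EllipticCurves.Rank1Residual.Typed
  Literature.NumberTheory.EllipticCurves.Kato2004 Literature.NumberTheory.EllipticCurves.IwasawaAlgebra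
  Literature.NumberTheory.GaloisRepresentations
open Summit.BirchSwinnertonDyer.Rank1Residual Summit.BirchSwinnertonDyer.Rank1Residual.Additive
  Summit.BirchSwinnertonDyer.Rank1Residual.X12.O10

namespace Summit.BirchSwinnertonDyer.Rank1Residual.Additive.StrictCount

/-- **The OFF-`μ` length equality on 𝒞₇ at `p = 7` from Burungale–Tian 2026 Thm. 2.6** (the body of
`Kato2004.BurungaleTian2026_lengthEq_offMu_of_hasCM` BY VALUE): for every `W ∈ 𝒞₇`, every cyclotomic `ℤ_7`-datum, pin, admissible `z₀`,
dual fine Selmer datum of key `γ⁻¹` and height-one `𝔮 ≠ (7)` of `ℤ_7⟦T⟧`, `length_𝔮 Y.X = length_𝔮 (𝐇¹ ⧸ Λz₀)`.  CONDITIONAL on `hfact`;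
vacuous on a member with no admissible class; nothing asserted. [cite: BurungaleTian2026, Thm. 2.6 (p. 5)] [cite: Kato2004Asterisque, Conj. 12.10 (p. 224); §15.14 (p. 264)] -/
theorem katoLengthEqualityOffMu_classCSeven_of_fact
    (hfact : ∀ (W : WeierstrassCurve ℚ) [W.IsElliptic] [W.IsGloballyMinimal] (p : ℕ) [Fact p.Prime]
      [ContinuousSMul ℤ_[p] (W.tateModule p)] (κ : ZpExtension ℚ p) (γ : absoluteGaloisGroup ℚ)
      (hκ : κ.IsCyclotomic), κ.IsTopGenerator γ → p ≠ 2 → W.HasCM →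
        ∀ (I : IwasawaH1Data W p κ γ) (z₀ : I.H), IsAdmissibleZetaClass W p κ hκ I z₀ →
          ∀ (Y : W.FineSelmerDualData κ γ⁻¹) (𝔮 : PrimeSpectrum (IwasawaAlgebra p)), 𝔮.asIdeal.height = 1 →
            𝔮.asIdeal ≠ IwasawaAlgebra.augIdealP p →
            Module.lengthAt (IwasawaAlgebra p) Y.X 𝔮 =
              Module.lengthAt (IwasawaAlgebra p) (I.H ⧸ (IwasawaAlgebra p) ∙ z₀) 𝔮) :
    ∀ (W : WeierstrassCurve ℚ) [W.IsElliptic] [W.IsGloballyMinimal] [Fact (Nat.Prime 7)], X12.ClassCSeven W →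
      letI : ContinuousSMul ℤ_[7] (W.tateModule 7) := TateModule.continuousSMul_padicInt
      ∀ (K : ZpExtension ℚ 7) (hK : K.IsCyclotomic) (γ : absoluteGaloisGroup ℚ) (_ : K.IsTopGenerator γ)
        (I : IwasawaH1Data W 7 K γ) (z₀ : I.H), IsAdmissibleZetaClass W 7 K hK I z₀ →
        ∀ (Y : W.FineSelmerDualData K γ⁻¹) (𝔮 : PrimeSpectrum (IwasawaAlgebra 7)), 𝔮.asIdeal.height = 1 →
          𝔮.asIdeal ≠ IwasawaAlgebra.augIdealP 7 →
          Module.lengthAt (IwasawaAlgebra 7) Y.X 𝔮 =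
            Module.lengthAt (IwasawaAlgebra 7) (I.H ⧸ (IwasawaAlgebra 7) ∙ z₀) 𝔮 := by
  intro W _ _ _ hC K hK γ hγ I z₀ hz₀ Y 𝔮 h𝔮 hne
  letI : ContinuousSMul ℤ_[7] (W.tateModule 7) := TateModule.continuousSMul_padicInt
  exact hfact W 7 K γ hK hγ (by decide) hC.1 I z₀ hz₀ Y 𝔮 h𝔮 hne

/-- **The zp research stub `stub_katoMainConjectureFineSeven` (`∀ W, X12.ClassCSeven W → KatoMainConjectureFineContra W 7`) SPLIT along
print**: it follows VERBATIM from (i) `hex` — an admissible zeta class EXISTS for every member (RESEARCH: Kato's integrality at the reducible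
prime `7`, not print), (ii) `hfact` — Burungale–Tian Thm. 2.6 BY VALUE (PRINT, the named fact p736588), (iii) `hat` — the `μ`-equality at
`𝔮 = (7)` on the class (RESEARCH, Rem. 2.7).  `by_cases` on `𝔮.asIdeal = augIdealP 7`; CONDITIONAL on the three hypotheses; nothing
asserted; 19945 stays OPEN. [cite: BurungaleTian2026, Thm. 2.6, Remark 2.7 (p. 5)] [cite: Kato2004Asterisque, Conj. 12.10 (p. 224); Prop. 15.21 (p. 266)] -/
theorem katoMainConjectureFineContra_classCSeven_of_exists_of_fact_of_atMu
    (hex : ∀ (W : WeierstrassCurve ℚ) [W.IsElliptic] [W.IsGloballyMinimal] [Fact (Nat.Prime 7)], X12.ClassCSeven W →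
      letI : ContinuousSMul ℤ_[7] (W.tateModule 7) := TateModule.continuousSMul_padicInt
      ∃ (K : ZpExtension ℚ 7) (hK : K.IsCyclotomic) (γ : absoluteGaloisGroup ℚ) (_ : K.IsTopGenerator γ)
        (I : IwasawaH1Data W 7 K γ) (z₀ : I.H), IsAdmissibleZetaClass W 7 K hK I z₀)
    (hfact : ∀ (W : WeierstrassCurve ℚ) [W.IsElliptic] [W.IsGloballyMinimal] (p : ℕ) [Fact p.Prime]
      [ContinuousSMul ℤ_[p] (W.tateModule p)] (κ : ZpExtension ℚ p) (γ : absoluteGaloisGroup ℚ)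
      (hκ : κ.IsCyclotomic), κ.IsTopGenerator γ → p ≠ 2 → W.HasCM →
        ∀ (I : IwasawaH1Data W p κ γ) (z₀ : I.H), IsAdmissibleZetaClass W p κ hκ I z₀ →
          ∀ (Y : W.FineSelmerDualData κ γ⁻¹) (𝔮 : PrimeSpectrum (IwasawaAlgebra p)), 𝔮.asIdeal.height = 1 →
            𝔮.asIdeal ≠ IwasawaAlgebra.augIdealP p →
            Module.lengthAt (IwasawaAlgebra p) Y.X 𝔮 =
              Module.lengthAt (IwasawaAlgebra p) (I.H ⧸ (IwasawaAlgebra p) ∙ z₀) 𝔮)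
    (hat : ∀ (W : WeierstrassCurve ℚ) [W.IsElliptic] [W.IsGloballyMinimal] [Fact (Nat.Prime 7)], X12.ClassCSeven W →
      letI : ContinuousSMul ℤ_[7] (W.tateModule 7) := TateModule.continuousSMul_padicInt
      ∀ (K : ZpExtension ℚ 7) (hK : K.IsCyclotomic) (γ : absoluteGaloisGroup ℚ) (_ : K.IsTopGenerator γ)
        (I : IwasawaH1Data W 7 K γ) (z₀ : I.H), IsAdmissibleZetaClass W 7 K hK I z₀ →
        ∀ (Y : W.FineSelmerDualData K γ⁻¹) (𝔮 : PrimeSpectrum (IwasawaAlgebra 7)), 𝔮.asIdeal.height = 1 →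
          𝔮.asIdeal = IwasawaAlgebra.augIdealP 7 →
          Module.lengthAt (IwasawaAlgebra 7) Y.X 𝔮 =
            Module.lengthAt (IwasawaAlgebra 7) (I.H ⧸ (IwasawaAlgebra 7) ∙ z₀) 𝔮) :
    ∀ (W : WeierstrassCurve ℚ) [W.IsElliptic] [W.IsGloballyMinimal] [Fact (Nat.Prime 7)],
      X12.ClassCSeven W → KatoMainConjectureFineContra W 7 := by
  intro W _ _ _ hC hp7
  refine ⟨hex W hC, ?_⟩
  intro K hK γ hγ I z₀ hz₀ Y 𝔮 h𝔮
  by_cases h : 𝔮.asIdeal = IwasawaAlgebra.augIdealP 7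
  · exact hat W hC K hK γ hγ I z₀ hz₀ Y 𝔮 h𝔮 h
  · exact katoLengthEqualityOffMu_classCSeven_of_fact hfact W hC K hK γ hγ I z₀ hz₀ Y 𝔮 h𝔮 h

end Summit.BirchSwinnertonDyer.Rank1Residual.Additive.StrictCount

end
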